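import Summits.Schanuel.Schanuel.Theorems.RootDecomp1BHyperFrame01

/-!
# RootDecomp1BHyperFrame — lens 4, generation 32 «HYPER-FRAME CELLS» (HyperFrame.lean f84fe52b…, 1151 l) — continuation (RootDecomp1BHyperFrame02): §E lemmas — `framePt`, `Ff`, `Qspec`, `gcoef`, size and coefficient bookkeeping for the engine

(lens-4 g32 `HyperFrame.lean`, sha256 f84fe52b…46c4, own farm rc 0 · 0 sorry · axioms std; critic VERDICT STATUS L1693 PORT GO LOW; port by census-1 gen 15
in five parts `RootDecomp1BHyperFrame01`–`05` — see the PORT NOTE of part 01 (tree binder `…RootDecomp1EPointTransfer.Roy2014_thm_1_1`); `--supports stmt-Schanuel-24622`; rung 0.)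
-/

noncomputable section

open Complex IntermediateField MvPolynomial

namespace Summit.Schanuel.Schanuel.Theorems.RootDecomp1BHyperFrame

open Summit.Schanuel.Schanuel.Theorems.RootDecomp1EPointTransfer (Roy2014_thm_1_1)

open Summit.Schanuel.Schanuel.Theorems.RootDecomp1KHyper (mvlen mvlen_nonneg abs_coeff_le_mvlen one_le_mvlen
  exists_int_mul_eq_map mvaeval_int_map exists_ball_eval_ne_zero transcendental_ofReal_of_liouville)
open Summit.Schanuel.Schanuel.Theorems.RootDecomp1KHyper.HyperCell (HyperLiouville lambdaH hyperLiouville_lambdaH)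
open Summit.Schanuel.Schanuel.Theorems.RootDecomp1BFedFlagCore (KleinIH polarDeg polarField polarGens
  coe_mem_polarField coe_mul_I_mem_polarField exp_coe_mem_polarField exp_coe_mul_I_mem_polarField)
open Summit.Schanuel.Schanuel.Theorems.RootDecomp1BTameFlagCore (IsWild isAlgebraic_I)
open Summit.Schanuel.Schanuel.Theorems.RootDecomp1BDefectFloorDefs (SharpRelativeLindemannAt TameDefectZeroAt
  WildSharpDefectZeroAt WildSharpDefectZeroInitAt WildSharpInitAt)
open Summit.Schanuel.Schanuel.Theorems.RootDecomp1BDefectFloorCells (polarDeg_le_two_mul_of_algebraic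
  isAlgebraic_of_mem_span_algebraic natCast_le_trdeg_of_algebraicIndependent linearIndependent_polar
  isAlgebraic_polarExp)
open Summit.Schanuel.Schanuel.Theorems.RootDecomp1BSRLLogLiouville (sharp_init_snoc)

section Engine

variable {n : ℕ}

/-- `x^k ≤ exp (k x)` for `x ≥ 0`. -/
private theorem pow_le_exp_mul {x : ℝ} (hx : 0 ≤ x) (k : ℕ) : x ^ k ≤ Real.exp (k * x) := by
  rw [Real.exp_nat_mul]
  exact pow_le_pow_left₀ hx (by linarith [Real.add_one_le_exp x]) k

/-- `exp(−x) < δ` once `x > δ⁻¹` (`δ > 0`). -/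
private theorem exp_neg_lt_of_inv_lt_HF {δ x : ℝ} (hδ : 0 < δ) (hx : δ⁻¹ < x) : Real.exp (-x) < δ := by
  rw [Real.exp_neg, inv_lt_comm₀ (Real.exp_pos _) hδ]
  linarith [Real.add_one_le_exp x]

/-- The ENDGAME inequality: `C ℓ + C d R b + C R^N b^N + d b + K < b^m` once `b ≥ 2` and `m ≥ N + 1 + k` with
`2^k > C ℓ + C d R + C R^N + d + K + 1`. -/
theorem engine_endgame {C ℓ d R K Γ : ℝ} {b N k m : ℕ} (hC : 0 ≤ C) (hℓ : 0 ≤ ℓ) (hd : 0 ≤ d)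
    (hR : 0 ≤ R) (hK : 0 ≤ K) (hΓ : Γ = C * ℓ + C * d * R + C * R ^ N + d + K + 1) (hk : Γ < 2 ^ k)
    (hb : 2 ≤ b) (hm : N + 1 + k ≤ m) :
    C * ℓ + C * d * R * b + C * R ^ N * (b : ℝ) ^ N + d * b + K < (b : ℝ) ^ m := by
  have hb1 : (1 : ℝ) ≤ b := by exact_mod_cast le_trans one_le_two hb
  have hb2 : (2 : ℝ) ≤ b := by exact_mod_cast hb
  obtain ⟨B, hB⟩ : ∃ B : ℝ, B = (b : ℝ) ^ (N + 1) := ⟨_, rfl⟩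
  have hbB : (b : ℝ) ≤ B := by rw [hB]; exact le_self_pow₀ hb1 (Nat.succ_ne_zero N)
  have hbNB : (b : ℝ) ^ N ≤ B := by rw [hB]; exact pow_le_pow_right₀ hb1 (Nat.le_succ N)
  have h1B : (1 : ℝ) ≤ B := by rw [hB]; exact one_le_pow₀ hb1
  have t1 : C * ℓ ≤ C * ℓ * B := le_mul_of_one_le_right (mul_nonneg hC hℓ) h1B
  have t2 : C * d * R * b ≤ C * d * R * B :=
    mul_le_mul_of_nonneg_left hbB (mul_nonneg (mul_nonneg hC hd) hR)
  have t3 : C * R ^ N * (b : ℝ) ^ N ≤ C * R ^ N * B :=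
    mul_le_mul_of_nonneg_left hbNB (mul_nonneg hC (pow_nonneg hR N))
  have t4 : d * b ≤ d * B := mul_le_mul_of_nonneg_left hbB hd
  have t5 : K ≤ K * B := le_mul_of_one_le_right hK h1B
  have hsum : C * ℓ + C * d * R * b + C * R ^ N * (b : ℝ) ^ N + d * b + K ≤ (Γ - 1) * B := by
    have h : (Γ - 1) * B = C * ℓ * B + C * d * R * B + C * R ^ N * B + d * B + K * B := by
      rw [hΓ]; ring
    rw [h]; linarith
  have h2k : (2 : ℝ) ^ k ≤ (b : ℝ) ^ k := pow_le_pow_left₀ zero_le_two hb2 k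
  have hBpos : 0 < B := lt_of_lt_of_le zero_lt_one h1B
  calc C * ℓ + C * d * R * b + C * R ^ N * (b : ℝ) ^ N + d * b + K ≤ (Γ - 1) * B := hsum
    _ < 2 ^ k * B := mul_lt_mul_of_pos_right (by linarith) hBpos
    _ ≤ (b : ℝ) ^ k * B := mul_le_mul_of_nonneg_right h2k hBpos.le
    _ = (b : ℝ) ^ (N + 1 + k) := by rw [hB, ← pow_add, add_comm]
    _ ≤ (b : ℝ) ^ m := pow_le_pow_right₀ hb1 hm

variable (P : MvPolynomial (Fin (n + 1)) ℤ) (y : Fin n → ℂ) (e : Fin n → ℕ)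

/-- The FRAME POINT `x ↦ (x, e^{x^{e₁} y₁}, …, e^{x^{eₙ} yₙ})`. -/
def framePt (x : ℝ) : Fin (n + 1) → ℂ :=
  Fin.cons (x : ℂ) (fun j => cexp ((x : ℂ) ^ (e j) * y j))

/-- `F(x) = P(framePt x)`, monomially expanded (so that it is visibly `C¹`). -/
def Ff (x : ℝ) : ℂ :=
  ∑ s ∈ P.support, ((P.coeff s : ℤ) : ℂ) *
    ((x : ℂ) ^ (s 0) * cexp (∑ j, (s j.succ : ℂ) * ((x : ℂ) ^ (e j) * y j)))

/-- `F(x) = P(framePt y e x)` as an `MvPolynomial.aeval`. -/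
theorem Ff_eq_aeval (x : ℝ) : Ff P y e x = aeval (framePt y e x) P := by
  unfold Ff framePt
  rw [MvPolynomial.aeval_def, MvPolynomial.eval₂_eq']
  refine Finset.sum_congr rfl fun s _ => ?_
  rw [Fin.prod_univ_succ]
  simp only [algebraMap_int_eq, eq_intCast, Fin.cons_zero, Fin.cons_succ]
  rw [Complex.exp_sum]
  simp_rw [← Complex.exp_nat_mul]

/-- `F` is `C¹` on `ℝ`. -/
theorem contDiff_Ff : ContDiff ℝ 1 (Ff P y e) := by
  have hx : ContDiff ℝ 1 (fun x : ℝ => (x : ℂ)) := Complex.ofRealCLM.contDiff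
  show ContDiff ℝ 1 (fun x => Ff P y e x)
  unfold Ff
  refine ContDiff.sum fun s _ => ?_
  refine contDiff_const.mul ((hx.pow _).mul (Complex.contDiff_exp.comp ?_))
  refine ContDiff.sum fun j _ => ?_
  exact contDiff_const.mul ((hx.pow _).mul contDiff_const)

/-- local Lipschitz bound of `F` at `ρ` -/
theorem exists_lipschitz_Ff (ρ : ℝ) :
    ∃ Kl δ₁ : ℝ, 0 ≤ Kl ∧ 0 < δ₁ ∧
      ∀ x : ℝ, |x - ρ| < δ₁ → ‖Ff P y e x - Ff P y e ρ‖ ≤ Kl * |x - ρ| := by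
  obtain ⟨K, t, ht, hK⟩ := ((contDiff_Ff P y e).contDiffAt (x := ρ)).exists_lipschitzOnWith
  obtain ⟨δ₁, hδ₁, hball⟩ := Metric.mem_nhds_iff.mp ht
  refine ⟨K, δ₁, K.2, hδ₁, fun x hx => ?_⟩
  have hxt : x ∈ t := hball (by rw [Metric.mem_ball, Real.dist_eq]; exact hx)
  have hρt : ρ ∈ t := hball (Metric.mem_ball_self hδ₁)
  have := (lipschitzOnWith_iff_dist_le_mul.mp hK) x hxt ρ hρt
  rwa [dist_eq_norm, Real.dist_eq] at this

/-- The CLEARED SPECIALISATION of the first variable at `a/b`: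
`Q_{a,b} = Σ_s coeff_s · a^{s₀} b^{d − s₀} · X^{tail s} = b^d · P(a/b, X) ∈ ℤ[X₁..Xₙ]`. -/
def Qspec (a : ℤ) (b d : ℕ) : MvPolynomial (Fin n) ℤ :=
  ∑ s ∈ P.support, monomial (Finsupp.tail s) (P.coeff s * a ^ (s 0) * (b : ℤ) ^ (d - s 0))

/-- The `0`-th exponent of a monomial of `P` is at most `P.totalDegree`. -/
theorem apply_zero_le_totalDegree {s : Fin (n + 1) →₀ ℕ} (hs : s ∈ P.support) :
    s 0 ≤ P.totalDegree := by
  refine le_trans ?_ (le_totalDegree hs)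
  rw [Finsupp.sum_fintype _ _ (fun _ => rfl), Fin.sum_univ_succ]
  exact Nat.le_add_right _ _

/-- The specialisation `Qspec P a b d` has total degree `≤ P.totalDegree`. -/
theorem totalDegree_Qspec_le (a : ℤ) (b d : ℕ) : (Qspec P a b d).totalDegree ≤ P.totalDegree := by
  unfold Qspec
  refine totalDegree_finsetSum_le fun s hs => ?_
  refine (totalDegree_monomial_le _ _).trans ?_
  refine le_trans ?_ (le_totalDegree hs)
  rw [Finsupp.sum_fintype _ _ (fun _ => rfl), Finsupp.sum_fintype _ _ (fun _ => rfl),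
    Fin.sum_univ_succ]
  simp only [Finsupp.tail_apply, id]
  omega

/-- Clearing denominators: `b^d · (a/b)^k = a^k · b^{d−k}` for `k ≤ d`, `b ≠ 0`. -/
private theorem pow_clear_HF {a b : ℂ} (hb : b ≠ 0) {k d : ℕ} (hk : k ≤ d) :
    b ^ d * (a / b) ^ k = a ^ k * b ^ (d - k) := by
  have h : b ^ d = b ^ k * b ^ (d - k) := by rw [← pow_add, Nat.add_sub_cancel' hk]
  rw [h, div_pow]
  field_simp

/-- `Q_{a,b}(θ) = b^d · P(a/b, θ)` -/
theorem aeval_Qspec (θ : Fin n → ℂ) {a : ℤ} {b d : ℕ} (hb : b ≠ 0)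
    (hd : ∀ s ∈ P.support, s 0 ≤ d) :
    aeval θ (Qspec P a b d) = (b : ℂ) ^ d * aeval (Fin.cons ((a : ℂ) / b) θ : Fin (n + 1) → ℂ) P := by
  have hbC : (b : ℂ) ≠ 0 := by exact_mod_cast hb
  unfold Qspec
  rw [map_sum]
  conv_rhs => rw [MvPolynomial.aeval_def, MvPolynomial.eval₂_eq', Finset.mul_sum]
  refine Finset.sum_congr rfl fun s hs => ?_
  rw [MvPolynomial.aeval_monomial, algebraMap_int_eq, eq_intCast,
    Finsupp.prod_fintype _ _ (fun _ => by simp), Fin.prod_univ_succ]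
  simp only [Finsupp.tail_apply, Fin.cons_zero, Fin.cons_succ, Int.cast_mul, Int.cast_pow,
    Int.cast_natCast, eq_intCast]
  linear_combination (-((P.coeff s : ℤ) : ℂ) * ∏ j, θ j ^ (s j.succ)) * pow_clear_HF (a := (a : ℂ)) hbC (hd s hs)

/-- the height of `Q_{a,b}`: every coefficient is at most `mvlen P · (|a| + b)^d` in absolute value -/
theorem abs_coeff_Qspec_le {a : ℤ} {b d : ℕ} (hd : ∀ s ∈ P.support, s 0 ≤ d) (s' : Fin n →₀ ℕ) :
    |(Qspec P a b d).coeff s'| ≤ mvlen P * (|a| + b) ^ d := by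
  classical
  unfold Qspec
  rw [MvPolynomial.coeff_sum]
  have hb0 : (0 : ℤ) ≤ (b : ℤ) := by positivity
  calc |∑ s ∈ P.support, MvPolynomial.coeff s'
          (monomial (Finsupp.tail s) (P.coeff s * a ^ (s 0) * (b : ℤ) ^ (d - s 0)))|
      ≤ ∑ s ∈ P.support, |MvPolynomial.coeff s'
          (monomial (Finsupp.tail s) (P.coeff s * a ^ (s 0) * (b : ℤ) ^ (d - s 0)))| :=
        Finset.abs_sum_le_sum_abs _ _
    _ ≤ ∑ s ∈ P.support, |P.coeff s| * (|a| + b) ^ d := Finset.sum_le_sum fun s hs => by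
        rw [MvPolynomial.coeff_monomial]
        split_ifs with h
        · rw [abs_mul, abs_mul, abs_pow, abs_pow, abs_of_nonneg hb0, mul_assoc]
          refine mul_le_mul_of_nonneg_left ?_ (abs_nonneg _)
          calc |a| ^ (s 0) * (b : ℤ) ^ (d - s 0) ≤ (|a| + b) ^ (s 0) * (|a| + b) ^ (d - s 0) :=
              mul_le_mul (pow_le_pow_left₀ (abs_nonneg _) (by linarith) _)
                (pow_le_pow_left₀ hb0 (by linarith [abs_nonneg a]) _) (by positivity) (by positivity)
            _ = (|a| + b) ^ d := by rw [← pow_add, Nat.add_sub_cancel' (hd s hs)]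
        · rw [abs_zero]; positivity
    _ = mvlen P * (|a| + b) ^ d := by rw [← Finset.sum_mul]; rfl

/-- the `X^{s'}`-coefficient of `P` as a polynomial in the FIRST variable:
`g_{s'}(Y) = Σ_{tail s = s'} coeff_s · Y^{s 0} ∈ ℤ[Y]`. -/
def gcoef (s' : Fin n →₀ ℕ) : Polynomial ℤ :=
  ∑ s ∈ P.support with Finsupp.tail s = s', Polynomial.monomial (s 0) (P.coeff s)

/-- An exponent vector on `Fin (n+1)` is determined by its `0`-th coordinate and its tail. -/
private theorem eq_of_zero_eq_of_tail_eq {s t : Fin (n + 1) →₀ ℕ} (h0 : s 0 = t 0)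
    (ht : Finsupp.tail s = Finsupp.tail t) : s = t :=
  calc s = Finsupp.cons (s 0) (Finsupp.tail s) := (Finsupp.cons_tail s).symm
    _ = Finsupp.cons (t 0) (Finsupp.tail t) := by rw [h0, ht]
    _ = t := Finsupp.cons_tail t

/-- The grouped coefficient at the tail of a monomial of `P` is non-zero. -/
theorem gcoef_ne_zero {s₀ : Fin (n + 1) →₀ ℕ} (hs₀ : s₀ ∈ P.support) :
    gcoef P (Finsupp.tail s₀) ≠ 0 := by
  classical
  intro h
  have hc : (gcoef P (Finsupp.tail s₀)).coeff (s₀ 0) = 0 := by rw [h, Polynomial.coeff_zero]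
  unfold gcoef at hc
  rw [Polynomial.finsetSum_coeff, Finset.sum_eq_single s₀] at hc
  · rw [Polynomial.coeff_monomial, if_pos rfl] at hc
    exact (MvPolynomial.mem_support_iff.mp hs₀) hc
  · intro s hs hne
    rw [Polynomial.coeff_monomial]
    split_ifs with h0
    · exact absurd (eq_of_zero_eq_of_tail_eq h0 (Finset.mem_filter.mp hs).2) hne
    · rfl
  · intro hnot
    exact (hnot (Finset.mem_filter.mpr ⟨hs₀, rfl⟩)).elim

/-- the coefficients of `Q_{a,b}` are the values `b^d g_{s'}(a/b)` -/
theorem coeff_Qspec_eq (s' : Fin n →₀ ℕ) {a : ℤ} {b d : ℕ} (hb : b ≠ 0)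
    (hd : ∀ s ∈ P.support, s 0 ≤ d) :
    (((Qspec P a b d).coeff s' : ℤ) : ℂ) =
      (b : ℂ) ^ d * ((gcoef P s').map (Int.castRingHom ℂ)).eval ((a : ℂ) / b) := by
  classical
  have hbC : (b : ℂ) ≠ 0 := by exact_mod_cast hb
  unfold Qspec gcoef
  rw [MvPolynomial.coeff_sum, Int.cast_sum, Polynomial.eval_map, Polynomial.eval₂_finsetSum,
    Finset.mul_sum, ← Finset.sum_filter_add_sum_filter_not P.support (fun s => Finsupp.tail s = s')]
  rw [Finset.sum_eq_zero (s := P.support.filter fun s => ¬ Finsupp.tail s = s') (fun s hs => by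
        rw [MvPolynomial.coeff_monomial, if_neg (Finset.mem_filter.mp hs).2, Int.cast_zero]), add_zero]
  refine Finset.sum_congr rfl fun s hs => ?_
  rw [MvPolynomial.coeff_monomial, if_pos (Finset.mem_filter.mp hs).2, Polynomial.eval₂_monomial]
  simp only [Int.cast_mul, Int.cast_pow, Int.cast_natCast, eq_intCast]
  linear_combination (-((P.coeff s : ℤ) : ℂ)) * pow_clear_HF (a := (a : ℂ)) hbC (hd s (Finset.mem_filter.mp hs).1)

end Engine

end Summit.Schanuel.Schanuel.Theorems.RootDecomp1BHyperFrame

end
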